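import Literature.Barriers.CriticalPhenomena.RigorousRGSmallParameterTorusGeometry
import Literature.Barriers.CriticalPhenomena.RigorousRGSmallParameterPolymerGas
import Literature.Barriers.CriticalPhenomena.RigorousRGSmallParameterLocProperties
import HarnessLib

/-!
# `RigorousRGSmallParameter` (Slade, Theorem 1.4.1): the small-set neighbourhood `B^□` contains
# everything within a block side of `B` — `reach(y, K) ⊆ B^□` for `y ∈ B`, `K ≤ L^j`

Companion ("proof architecture") file of
`Literature/Barriers/CriticalPhenomena/RigorousRGSmallParameter.lean`. Field locality in the space
`𝒦_j` of Slade's Definition 6.1.2 is relative to the small-set neighbourhood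
"`X^□ = ⋃_{Y ∈ 𝒮_j : X ∩ Y ≠ ∅} Y`" of "small sets: connected polymers consisting of at most `2^d`
blocks"; the interaction `I_j(V,B) = e^{-V(B)}(1+W_j(V,B))` and the transfers `J(X,B) = Loc_{X,B}(⋯)`
depend on fields in a neighbourhood of `B` of radius the range `½L^j` of `w_j`, resp. the reach
`⌊d_+⌋` of the local monomials (`…PerturbativeRange.dependsOn_FC_localPoly_localPolySum`,
`…LocProperties.dependsOn_locX`, `…MapOneTransfer.dependsOn_mapOneJ`, all phrased with
`Loc.reach`). This file PROVES the geometric fact that makes these compatible ("the specific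
number `2^d` is important in [BS-rg-step]", Slade §6.1):

* `IsConn.union_of_touch`, `numBlocks_union_le`;
* `mix x y k` (interpolating one coordinate at a time), **`touch_block_mix_succ`** (consecutive
  interpolants have touching `b`-blocks when `cycDist(x_i,y_i) ≤ b`, `b ∣ M`; from
  `…TorusGeometry.exists_key_pair_of_cycDist_le`), `chain_mix` (the chain of the `≤ d+1 ≤ 2^d`
  blocks `B(mix x y k)` is a connected polymer, hence a small set);
* **`mem_sclosure_block_of_cycDist_le`**: `y ∈ B_b(x)^□` whenever `cycDist(x_i, y_i) ≤ b` for all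
  `i`; `cycDist_eq_natAbs_valMinAbs`; **`reach_subset_sclosure_block`**: `reach(y,K) ⊆ B_b(x)^□`
  for `y ∈ B_b(x)`, `K ≤ b`.

Sources: G. Slade, arXiv:1611.06169, §6.1 (small sets, `X^□`), Definition 6.1.2 (field
locality); D. C. Brydges, G. Slade, arXiv:1403.7256, §1.2 (Definition: small sets, "do not
touch"), §4.1 ((4.3): `J(U,B) ∈ 𝒩(B^□)`).

## References

* [BrydgesSlade2015RGV] D. C. Brydges, G. Slade, *A renormalisation group method. V. A single
  renormalisation group step*, J. Stat. Phys. **159** (2015) 589–667, arXiv:1403.7256.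
* [Slade2017] G. Slade, *Critical exponents for long-range O(n) models below the upper critical
  dimension*, Commun. Math. Phys. **358** (2018) 343–436, arXiv:1611.06169.
-/

noncomputable section

open Finset

namespace Literature.Barriers.CriticalPhenomena

namespace LongRangePhi4

namespace Polymer

open Literature.Probability.LatticeModels

variable {d M : ℕ} [NeZero M]

/-! ### Unions of touching connected sets -/

omit [NeZero M] in
/-- The union of two connected sets that touch is connected. [folklore] -/
theorem IsConn.union_of_touch {X Y : Finset (TorusSite d M)} (hX : IsConn X) (hY : IsConn Y) (h : Touch X Y) :
    IsConn (X ∪ Y) := by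
  obtain ⟨x₀, hx₀, y₀, hy₀, hxy⟩ := h
  have hstep : ConnIn (X ∪ Y) x₀ y₀ :=
    connIn_of_eq_or_adjInf (mem_union_left _ hx₀) (mem_union_right _ hy₀) hxy
  refine ⟨⟨x₀, mem_union_left _ hx₀⟩, fun u hu v hv => ?_⟩
  rcases mem_union.1 hu with hu | hu <;> rcases mem_union.1 hv with hv | hv
  · exact (hX.2 u hu v hv).mono subset_union_left
  · exact ((hX.2 u hu x₀ hx₀).mono subset_union_left).trans (hstep.trans ((hY.2 y₀ hy₀ v hv).mono subset_union_right))
  · exact ((hY.2 u hu y₀ hy₀).mono subset_union_right).trans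
      (hstep.symm.trans ((hX.2 x₀ hx₀ v hv).mono subset_union_left))
  · exact (hY.2 u hu v hv).mono subset_union_right

/-- `|ℬ(X ∪ Y)| ≤ |ℬ(X)| + |ℬ(Y)|`. [folklore] -/
theorem numBlocks_union_le (b : ℕ) (X Y : Finset (TorusSite d M)) : numBlocks b (X ∪ Y) ≤ numBlocks b X + numBlocks b Y := by
  unfold numBlocks
  rw [blocksOf_union]
  exact Finset.card_union_le _ _

/-! ### Interpolating between two points one coordinate at a time -/

/-- `mix x y k`: the point with the first `k` coordinates of `y` and the remaining ones of `x`. [folklore] -/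
def mix (x y : TorusSite d M) (k : ℕ) : TorusSite d M := fun i => if i.val < k then y i else x i

omit [NeZero M] in
/-- `mix x y 0 = x`. [folklore] -/
@[simp] theorem mix_zero (x y : TorusSite d M) : mix x y 0 = x := by
  funext i; simp [mix]

omit [NeZero M] in
/-- `mix x y d = y`. [folklore] -/
theorem mix_self (x y : TorusSite d M) : mix x y d = y := by
  funext i; simp [mix, i.isLt]

/-- **Consecutive interpolants have touching blocks** when `x, y` are within a block side
coordinatewise (`b ∣ M`). [folklore] -/
theorem touch_block_mix_succ {b : ℕ} (hb : 0 < b) (hbM : b ∣ M) {x y : TorusSite d M}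
    (hxy : ∀ i, cycDist (x i) (y i) ≤ b) (k : ℕ) (hk : k < d) :
    Touch (block b (mix x y k)) (block b (mix x y (k + 1))) := by
  obtain ⟨p, q, hp, hq, hpq⟩ := exists_key_pair_of_cycDist_le hb hbM (hxy ⟨k, hk⟩)
  -- `P` agrees with `mix k` except in coordinate `k` where it is `p`; `Q` likewise with `q`
  set P : TorusSite d M := fun i => if i.val = k then p else mix x y k i with hP
  set Q : TorusSite d M := fun i => if i.val = k then q else mix x y k i with hQ
  have hPmem : P ∈ block b (mix x y k) := by
    rw [mem_block]
    funext i
    simp only [blockKey, hP]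
    by_cases hi : i.val = k
    · rw [if_pos hi]
      have : mix x y k i = x i := by simp [mix, hi]
      rw [this, hp]
      have : (⟨k, hk⟩ : Fin d) = i := Fin.ext hi.symm
      rw [← this]
    · rw [if_neg hi]
  have hQmem : Q ∈ block b (mix x y (k + 1)) := by
    rw [mem_block]
    funext i
    simp only [blockKey, hQ]
    by_cases hi : i.val = k
    · rw [if_pos hi]
      have : mix x y (k + 1) i = y i := by simp [mix, hi]
      rw [this, hq]
      have : (⟨k, hk⟩ : Fin d) = i := Fin.ext hi.symm
      rw [← this]
    · rw [if_neg hi]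
      have : mix x y (k + 1) i = mix x y k i := by
        simp only [mix]
        by_cases h1 : i.val < k
        · rw [if_pos h1, if_pos (by omega)]
        · rw [if_neg h1, if_neg (by omega)]
      rw [this]
  refine ⟨P, hPmem, Q, hQmem, ?_⟩
  by_cases hPQ : P = Q
  · exact Or.inl hPQ
  · refine Or.inr ⟨hPQ, fun i => ?_⟩
    by_cases hi : i.val = k
    · simp only [hP, hQ, if_pos hi]
      exact hpq
    · simp [hP, hQ, hi]

/-- The chain `⋃_{i ≤ k} B(mix x y i)` is a connected polymer with at most `k+1` blocks. [folklore] -/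
theorem chain_mix {b : ℕ} (hb : 0 < b) (hbM : b ∣ M) {x y : TorusSite d M} (hxy : ∀ i, cycDist (x i) (y i) ≤ b) :
    ∀ k, k ≤ d → IsPolymer b ((Finset.range (k + 1)).biUnion fun i => block b (mix x y i)) ∧
      IsConn ((Finset.range (k + 1)).biUnion fun i => block b (mix x y i)) ∧
      numBlocks b ((Finset.range (k + 1)).biUnion fun i => block b (mix x y i)) ≤ k + 1
  | 0, _ => by
      simp only [zero_add, Finset.range_one, Finset.singleton_biUnion]
      exact ⟨isPolymer_block b _, isConn_block b _, by rw [numBlocks_block]⟩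
  | k + 1, hk => by
      obtain ⟨hp, hc, hn⟩ := chain_mix hb hbM hxy k (by omega)
      rw [Finset.range_add_one, Finset.biUnion_insert, Finset.union_comm]
      refine ⟨hp.union (isPolymer_block b _), hc.union_of_touch (isConn_block b _) ?_, ?_⟩
      · refine (touch_block_mix_succ hb hbM hxy k (by omega)).mono ?_ (subset_refl _)
        exact Finset.subset_biUnion_of_mem (fun i => block b (mix x y i)) (Finset.mem_range.2 (by omega))
      · calc numBlocks b (_ ∪ block b (mix x y (k + 1))) ≤ numBlocks b _ + numBlocks b (block b (mix x y (k + 1))) :=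
              numBlocks_union_le b _ _
          _ ≤ (k + 1) + 1 := by rw [numBlocks_block]; omega

/-- **Points within a block side of `x` lie in the small-set neighbourhood of the block of `x`**:
if `cycDist(x_i, y_i) ≤ b` for all `i` (`b ∣ M`, `d + 1 ≤ 2^d`), then `y ∈ B_b(x)^□` — the chain of
the `d + 1` blocks `B(mix x y k)` is a small set containing `B_b(x)` and `y`. [folklore] -/
theorem mem_sclosure_block_of_cycDist_le {b : ℕ} (hb : 0 < b) (hbM : b ∣ M) {x y : TorusSite d M}
    (hxy : ∀ i, cycDist (x i) (y i) ≤ b) : y ∈ sclosure b (block b x) := by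
  obtain ⟨hp, hc, hn⟩ := chain_mix hb hbM hxy d le_rfl
  set Y := (Finset.range (d + 1)).biUnion fun i => block b (mix x y i) with hY
  have hsmall : IsSmall b Y := ⟨hp, hc, hn.trans (Nat.succ_le_of_lt Nat.lt_two_pow_self)⟩
  have hsub : ∀ k, k ≤ d → block b (mix x y k) ⊆ Y := fun k hk =>
    Finset.subset_biUnion_of_mem (fun i => block b (mix x y i)) (Finset.mem_range.2 (by omega))
  refine mem_sclosure.2 ⟨Y, hsmall, ⟨x, mem_inter.2 ⟨mem_block_self b x, ?_⟩⟩, ?_⟩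
  · have h0 := hsub 0 (Nat.zero_le d) (mem_block_self b (mix x y 0))
    rwa [mix_zero] at h0
  · have hd := hsub d le_rfl (mem_block_self b (mix x y d))
    rwa [mix_self] at hd

/-! ### The reach of a point of a block lies in the block's small-set neighbourhood -/

/-- The cyclic distance is the absolute value of the centred representative of the difference. [folklore] -/
theorem cycDist_eq_natAbs_valMinAbs (y z : ZMod M) : cycDist y z = (z - y).valMinAbs.natAbs := by
  rw [ZMod.valMinAbs_natAbs_eq_min]
  unfold cycDist fdist
  by_cases h : z - y = 0
  · have hyz : y - z = 0 := by rw [← neg_sub, h, neg_zero]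
    rw [h, hyz, ZMod.val_zero]
    simp
  · have e : y - z = -(z - y) := by ring
    rw [e, ZMod.neg_val, if_neg h]

/-- **`reach(y, K) ⊆ B^□` for `y ∈ B = B_b(x)` and `K ≤ b`** (`b ∣ M`): monomials of order `≤ b` at
points of a block, and kernels of range `≤ b` centred in a block, only see fields in the block's
small-set neighbourhood. [folklore] -/
theorem reach_subset_sclosure_block {b K : ℕ} (hb : 0 < b) (hbM : b ∣ M) (hK : K ≤ b) {x y : TorusSite d M}
    (hy : y ∈ block b x) : Loc.reach y K ⊆ sclosure b (block b x) := by
  intro z hz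
  rw [Loc.mem_reach] at hz
  rw [← block_eq_of_mem hy]
  refine mem_sclosure_block_of_cycDist_le hb hbM fun i => ?_
  have h := hz i
  rw [cycDist_eq_natAbs_valMinAbs]
  have : ((z i - y i).valMinAbs.natAbs : ℤ) ≤ K := by
    rw [← Int.abs_eq_natAbs]
    exact h
  omega

end Polymer

end LongRangePhi4

end Literature.Barriers.CriticalPhenomena
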